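import Summits.QuantumFields.YangMills.Theorems.ThermalDescentTorusDictionary
import Summits.QuantumFields.YangMills.Theorems.BalabanLadderNTMarkovMirrorReflect
import HarnessLib

/-!
# The REFLECTED torus dictionary: `Fin`-torus site reflection `refl` ↔ `ℤ⁴` time reflection `Θ₀ = cfgReflect`

Helper toward the glue item `SqueezedSkewness.AntipodalMarkovGlue` (stmt-QuantumFields-23391; planner ym-idea-6 g11, LINE
«Markov ceiling»; bears_on R2a / stmt-QuantumFields-19353 `BalabanLadder.NT` via the route's `closes`).  The route items of
`SqueezedSkewness` / `ThermalDescent` are typed on the `Fin`-torus `(Fin T)⁴` (time = LAST coordinate, centred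
coordinates, normalised weight `w/Z`, site reflection `refl`), while the tree's Markov-mirror identity X2
(`Cruxes.NT.MarkovMirror.torusCov_reflect_lift_eq_torusCov_reflect_kerE`) lives in the `torusE` vocabulary of the route Defs
(periodic lift of the `ZMod`-torus Wilson measure, time = coordinate `0`, reflection `cfgReflect`).  The unreflected
dictionary is `ThermalDescentTorusDictionary` (`eF_eq_wilsonExpectation`, `torusCov_eq_covF`, `zOf`); this file adds the
reflection:

* `reflF_equiv` — under the link reindexing `finTorusConfigEquivSite` the route's `refl` (spelled out verbatim, no
  definition is introduced) is `configPerm ρ⁻¹ ∘ GaugeConfig.negReflect ∘ configPerm ρ` (`ρ = finRotate 4`, the axis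
  rotation putting time first; `Fin.rev t = −(t+1)`, `⟨(T−t) % T⟩ = −t`); `lift_refl_equiv` — composed with the rotated
  periodic lift it is `Θ₀ = cfgReflect` (`torusLift_negReflect`);
* the transport `V ↦ Φ (lift (ρ · σ⁻¹ V))` of a `ℤ⁴` observable `Φ` to the `Fin`-torus (spelled out): `eF_toFin`,
  `eF_toFin_reflF(_mul)`, `covF_toFin_reflF` — **`Cov_P((Φ-transport) ∘ refl, Ψ-transport) = Cov_T(Φ ∘ Θ₀, Ψ)`** in the
  `torusE` vocabulary (axis-rotation invariance `wilsonMeasure_map_configPerm`); `toFin_dens_zOf` — the transport of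
  `dens (zOf u)` is the plaquette sum `A_u`;
* `torusLift_configPerm_symm_apply`, `toFin_congr`, `measurable_toFin`, `finLink_fst`, `min_val_intCast_le`,
  `min_natAbs_val_intCast_le` — the `Fin`-link read at a `ℤ⁴` link, locality / measurability transport, and the torus
  distances of the links read (for the locality clause of `AntipodalMixing`).

Fleet lead `ym-spine-19353-p1` g19.  Pure lattice bookkeeping; no summit, rung, crux or mass gap is proved here. [folklore]
-/

set_option autoImplicit false

namespace Summit.QuantumFields.YangMills.Theorems.AntipodalMarkovDictionary

open MeasureTheory Literature.MathematicalPhysics.QuantumFieldTheory Literature.MathematicalPhysics.QuantumLattice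
open Literature.Probability.LatticeModels (Torus.proj Torus.proj_apply)
open Summit.QuantumFields.YangMills.Cruxes.OSLegsFromFemtoAndGap.DlrCollarTransfer (torusE dens)
open Summit.QuantumFields.YangMills.Theorems.ThermalDescentTorusDictionary

variable {G : Type}

variable [MeasurableSpace G]

/-- `Fin.rev t = −(t + 1)` in `Fin (T+1)`. [folklore] -/
theorem fin_rev_eq_neg (T : ℕ) (t : Fin (T + 1)) : Fin.rev t = -(t + 1) := by
  apply Fin.ext
  rw [Fin.val_rev, Fin.neg_def, Fin.val_add]
  simp only [Fin.val_one', Nat.add_mod_mod]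
  by_cases h : (t : ℕ) + 1 < T + 1
  · rw [Nat.mod_eq_of_lt h, Nat.mod_eq_of_lt (by omega)]
  · have ht : (t : ℕ) + 1 = T + 1 := by omega
    simp only [ht, Nat.mod_self, Nat.sub_zero]; omega

/-- The route's spelled-out negation `⟨(T − t) % T, _⟩` is `−t`. [folklore] -/
theorem fin_neg_mk (T : ℕ) (t : Fin (T + 1)) :
    (⟨(T + 1 - t.val) % (T + 1), Nat.mod_lt _ t.pos⟩ : Fin (T + 1)) = -t := rfl

/-- **The route's reflection is the conjugated tree reflection under the link reindexing.** [folklore] -/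
theorem reflF_equiv [Group G] (L : ℕ) (U : GaugeConfig 4 (2 * L + 1) G) :
    (fun e => if e.2 = Fin.last 3 then ((finTorusConfigEquivSite G (2 * L + 1) U) ((e.1.1, e.1.2.1, e.1.2.2.1, Fin.rev e.1.2.2.2), Fin.last 3))⁻¹ else (finTorusConfigEquivSite G (2 * L + 1) U) ((e.1.1, e.1.2.1, e.1.2.2.1, ⟨((2 * L + 1) - e.1.2.2.2.val) % (2 * L + 1), Nat.mod_lt _ e.1.2.2.2.pos⟩), e.2)) =
      finTorusConfigEquivSite G (2 * L + 1) (configPerm (finRotate 4).symm (GaugeConfig.negReflect (configPerm (finRotate 4) U))) := by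
  funext ⟨⟨x1, x2, x3, t⟩, μ⟩
  simp only [coe_finTorusConfigEquivSite, configPerm_apply, Equiv.symm_symm, GaugeConfig.negReflect]
  have hrot : ∀ ν : Fin 4, (finRotate 4) ν = 0 ↔ ν = Fin.last 3 := by decide
  by_cases hμ : μ = Fin.last 3
  · subst hμ
    rw [if_pos rfl, if_pos ((hrot _).2 rfl)]
    congr 2
    refine Prod.ext ?_ (show Fin.last 3 = (finRotate 4).symm 0 by decide)
    funext j
    simp only [finTorusSiteEquivSite, Equiv.coe_fn_mk, Literature.MathematicalPhysics.QuantumFieldTheory.sitePerm_apply,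
      Site.negReflect, Site.shift]
    fin_cases j <;> simp [fin_rev_eq_neg, ZMod.finEquiv]
  · rw [if_neg hμ, if_neg (mt (hrot μ).1 hμ)]
    congr 1
    refine Prod.ext ?_ ?_
    · funext j
      simp only [finTorusSiteEquivSite, Equiv.coe_fn_mk,
        Literature.MathematicalPhysics.QuantumFieldTheory.sitePerm_apply, Site.negReflect]
      fin_cases j <;> simp [ZMod.finEquiv, fin_neg_mk]
    · simp


/-- `configPerm π ∘ configPerm π⁻¹ = id`. [folklore] -/
theorem configPerm_apply_symm {T : ℕ} (π : Equiv.Perm (Fin 4)) (U : GaugeConfig 4 T G) :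
    configPerm π (configPerm π.symm U) = U := by
  funext e
  simp only [configPerm_apply, Equiv.symm_symm]
  congr 1
  refine Prod.ext ?_ (by simp)
  funext j
  simp [Literature.MathematicalPhysics.QuantumFieldTheory.sitePerm_apply]

/-- Under the axis rotation (time LAST ↦ time FIRST) and the periodic lift, the last-coordinate reflection is the
tree's `ℤ⁴` time reflection `cfgReflect`. [folklore] -/
theorem torusLift_configPerm_negReflect₃ [Group G] {T : ℕ} [NeZero T] (U : GaugeConfig 4 T G) :
    torusLift T (configPerm (finRotate 4) (configPerm (finRotate 4).symm (GaugeConfig.negReflect (configPerm (finRotate 4) U)))) =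
      cfgReflect (torusLift T (configPerm (finRotate 4) U)) := by
  rw [configPerm_apply_symm, torusLift_negReflect]

/-! ### Transport of `ℤ⁴`-observables to the `Fin`-torus -/

/-- **The reflected lift**: reindex the route-reflected configuration, rotate, lift — this is `Θ₀` of the rotated lift.
[folklore] -/
theorem lift_refl_equiv [Group G] (L : ℕ) (U : GaugeConfig 4 (2 * L + 1) G) :
    torusLift (2 * L + 1) (configPerm (finRotate 4) ((finTorusConfigEquivSite G (2 * L + 1)).symm
      (fun e => if e.2 = Fin.last 3 then ((finTorusConfigEquivSite G (2 * L + 1) U) ((e.1.1, e.1.2.1, e.1.2.2.1, Fin.rev e.1.2.2.2), Fin.last 3))⁻¹ else (finTorusConfigEquivSite G (2 * L + 1) U) ((e.1.1, e.1.2.1, e.1.2.2.1, ⟨((2 * L + 1) - e.1.2.2.2.val) % (2 * L + 1), Nat.mod_lt _ e.1.2.2.2.pos⟩), e.2)))) =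
      cfgReflect (torusLift (2 * L + 1) (configPerm (finRotate 4) U)) := by
  rw [reflF_equiv, MeasurableEquiv.symm_apply_apply, torusLift_configPerm_negReflect₃]

/-- The transported configuration reads the `Fin`-link `finLink e` at the `ℤ⁴` link `e`. [folklore] -/
theorem torusLift_configPerm_symm_apply {T : ℕ} [NeZero T] (V : FinTorusSite T T T T × Fin 4 → G)
    (e : Literature.MathematicalPhysics.QuantumLattice.ZdEdge 4) :
    torusLift T (configPerm (finRotate 4) ((finTorusConfigEquivSite G T).symm V)) e =
      V ((finTorusSiteEquivSite T).symm (Literature.MathematicalPhysics.QuantumFieldTheory.sitePerm (finRotate 4).symm (Torus.proj T e.1)), (finRotate 4).symm e.2) := by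
  have hV : (finTorusConfigEquivSite G T).symm V = fun e' => V ((finTorusSiteEquivSite T).symm e'.1, e'.2) := by
    apply (finTorusConfigEquivSite G T).injective
    rw [MeasurableEquiv.apply_symm_apply]
    funext l
    simp [coe_finTorusConfigEquivSite]
  simp only [torusLift, torusEdge, Function.comp_apply, configPerm_apply, hV]

/-- **Locality transport.**  If `Φ` reads only the links of `S`, then `toFin Φ` reads only the `Fin`-links
`finLink e`, `e ∈ S`. [folklore] -/
theorem toFin_congr {T : ℕ} [NeZero T] {Φ : LGConfig 4 G → ℝ} {S : Finset (Literature.MathematicalPhysics.QuantumLattice.ZdEdge 4)} (hΦ : IsCylinder Φ S)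
    {V V' : FinTorusSite T T T T × Fin 4 → G}
    (h : ∀ e ∈ S, V ((finTorusSiteEquivSite T).symm (Literature.MathematicalPhysics.QuantumFieldTheory.sitePerm (finRotate 4).symm (Torus.proj T e.1)), (finRotate 4).symm e.2) =
      V' ((finTorusSiteEquivSite T).symm (Literature.MathematicalPhysics.QuantumFieldTheory.sitePerm (finRotate 4).symm (Torus.proj T e.1)), (finRotate 4).symm e.2)) :
    Φ (torusLift T (configPerm (finRotate 4) ((finTorusConfigEquivSite G T).symm V))) =
      Φ (torusLift T (configPerm (finRotate 4) ((finTorusConfigEquivSite G T).symm V'))) := by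
  refine hΦ fun e he => ?_
  rw [torusLift_configPerm_symm_apply, torusLift_configPerm_symm_apply]
  exact h e (Finset.mem_coe.1 he)

/-- Measurability of the transported observable. [folklore] -/
theorem measurable_toFin {T : ℕ} [NeZero T] {Φ : LGConfig 4 G → ℝ} (hΦ : Measurable Φ) :
    Measurable (fun V => Φ (torusLift T (configPerm (finRotate 4) ((finTorusConfigEquivSite G T).symm V)))) := by
  have h1 : Measurable (torusLift (d := 4) (G := G) T) :=
    measurable_pi_lambda _ fun e => measurable_pi_apply _
  exact hΦ.comp (h1.comp ((configPerm (finRotate 4)).measurable.comp (finTorusConfigEquivSite G T).symm.measurable))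

/-- `configPerm π⁻¹ ∘ configPerm π = id`. [folklore] -/
theorem configPerm_symm_apply' {T : ℕ} (π : Equiv.Perm (Fin 4)) (U : GaugeConfig 4 T G) :
    configPerm π.symm (configPerm π U) = U := by
  simpa only [Equiv.symm_symm] using configPerm_apply_symm π.symm U

/-! ### Expectations: `Fin`-torus ↔ periodic box -/

section Expect

variable [Group G] [TopologicalSpace G] [IsTopologicalGroup G] [CompactSpace G] [BorelSpace G] (r : LatticeRep G)

/-- `E_P[toFin Φ] = ⟨Φ ∘ lift⟩`. [folklore] -/
theorem eF_toFin (β : ℝ) (T : ℕ) [NeZero T] (Φ : LGConfig 4 G → ℝ) :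
    eF r β T (fun V => Φ (torusLift T (configPerm (finRotate 4) ((finTorusConfigEquivSite G T).symm V)))) =
      wilsonExpectation r.ρ β (fun U : GaugeConfig 4 T G => Φ (torusLift T U)) := by
  rw [eF_eq_wilsonExpectation, ← wilsonExpectation_configPerm r β T (finRotate 4) (fun U => Φ (torusLift T U))]
  congr 1
  funext U
  rw [MeasurableEquiv.symm_apply_apply]

/-- `E_P[(toFin Φ ∘ refl) · toFin Ψ] = ⟨(Φ ∘ Θ₀ ∘ lift) · (Ψ ∘ lift)⟩` on the odd torus. [folklore] -/
theorem eF_toFin_reflF_mul (β : ℝ) (L : ℕ) (Φ Ψ : LGConfig 4 G → ℝ) :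
    eF r β (2 * L + 1) (fun V => Φ (torusLift (2 * L + 1) (configPerm (finRotate 4) ((finTorusConfigEquivSite G (2 * L + 1)).symm (fun e => if e.2 = Fin.last 3 then (V ((e.1.1, e.1.2.1, e.1.2.2.1, Fin.rev e.1.2.2.2), Fin.last 3))⁻¹ else V ((e.1.1, e.1.2.1, e.1.2.2.1, ⟨((2 * L + 1) - e.1.2.2.2.val) % (2 * L + 1), Nat.mod_lt _ e.1.2.2.2.pos⟩), e.2))))) *
      Ψ (torusLift (2 * L + 1) (configPerm (finRotate 4) ((finTorusConfigEquivSite G (2 * L + 1)).symm V)))) =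
      wilsonExpectation r.ρ β (fun U : GaugeConfig 4 (2 * L + 1) G =>
        Φ (cfgReflect (torusLift (2 * L + 1) U)) * Ψ (torusLift (2 * L + 1) U)) := by
  rw [eF_eq_wilsonExpectation, ← wilsonExpectation_configPerm r β (2 * L + 1) (finRotate 4)
    (fun U => Φ (cfgReflect (torusLift (2 * L + 1) U)) * Ψ (torusLift (2 * L + 1) U))]
  congr 1
  funext U
  rw [MeasurableEquiv.symm_apply_apply, lift_refl_equiv]

/-- `E_P[toFin Φ ∘ refl] = ⟨Φ ∘ Θ₀ ∘ lift⟩` on the odd torus. [folklore] -/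
theorem eF_toFin_reflF (β : ℝ) (L : ℕ) (Φ : LGConfig 4 G → ℝ) :
    eF r β (2 * L + 1) (fun V => Φ (torusLift (2 * L + 1) (configPerm (finRotate 4) ((finTorusConfigEquivSite G (2 * L + 1)).symm (fun e => if e.2 = Fin.last 3 then (V ((e.1.1, e.1.2.1, e.1.2.2.1, Fin.rev e.1.2.2.2), Fin.last 3))⁻¹ else V ((e.1.1, e.1.2.1, e.1.2.2.1, ⟨((2 * L + 1) - e.1.2.2.2.val) % (2 * L + 1), Nat.mod_lt _ e.1.2.2.2.pos⟩), e.2)))))) =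
      wilsonExpectation r.ρ β (fun U : GaugeConfig 4 (2 * L + 1) G => Φ (cfgReflect (torusLift (2 * L + 1) U))) := by
  rw [eF_eq_wilsonExpectation, ← wilsonExpectation_configPerm r β (2 * L + 1) (finRotate 4)
    (fun U => Φ (cfgReflect (torusLift (2 * L + 1) U)))]
  congr 1
  funext U
  rw [lift_refl_equiv]

/-- **The reflected covariance dictionary**: the `Fin`-torus reflection covariance of the transported observables is
the mirror covariance `Cov_T(Φ∘Θ₀, Ψ)` in the `torusE` vocabulary of the route Defs. [folklore] -/
theorem covF_toFin_reflF (β : ℝ) (L : ℕ) (Φ Ψ : LGConfig 4 G → ℝ) :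
    eF r β (2 * L + 1) (fun V => Φ (torusLift (2 * L + 1) (configPerm (finRotate 4) ((finTorusConfigEquivSite G (2 * L + 1)).symm (fun e => if e.2 = Fin.last 3 then (V ((e.1.1, e.1.2.1, e.1.2.2.1, Fin.rev e.1.2.2.2), Fin.last 3))⁻¹ else V ((e.1.1, e.1.2.1, e.1.2.2.1, ⟨((2 * L + 1) - e.1.2.2.2.val) % (2 * L + 1), Nat.mod_lt _ e.1.2.2.2.pos⟩), e.2))))) *
          Ψ (torusLift (2 * L + 1) (configPerm (finRotate 4) ((finTorusConfigEquivSite G (2 * L + 1)).symm V)))) -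
        eF r β (2 * L + 1) (fun V => Φ (torusLift (2 * L + 1) (configPerm (finRotate 4) ((finTorusConfigEquivSite G (2 * L + 1)).symm (fun e => if e.2 = Fin.last 3 then (V ((e.1.1, e.1.2.1, e.1.2.2.1, Fin.rev e.1.2.2.2), Fin.last 3))⁻¹ else V ((e.1.1, e.1.2.1, e.1.2.2.1, ⟨((2 * L + 1) - e.1.2.2.2.val) % (2 * L + 1), Nat.mod_lt _ e.1.2.2.2.pos⟩), e.2)))))) *
          eF r β (2 * L + 1) (fun V => Ψ (torusLift (2 * L + 1) (configPerm (finRotate 4) ((finTorusConfigEquivSite G (2 * L + 1)).symm V)))) =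
      torusE G r β L (fun V => Φ (cfgReflect V) * Ψ V) - torusE G r β L (fun V => Φ (cfgReflect V)) * torusE G r β L Ψ := by
  rw [eF_toFin_reflF_mul, eF_toFin_reflF, eF_toFin]
  rfl

/-- **The action density transports to the plaquette sum**: `toFin (dens (zOf u)) = A_u`. [folklore] -/
theorem toFin_dens_zOf (L : ℕ) (u : FinTorusSite (2 * L + 1) (2 * L + 1) (2 * L + 1) (2 * L + 1)) :
    (fun V => (dens G r (zOf (2 * L + 1) u)) (torusLift (2 * L + 1) (configPerm (finRotate 4) ((finTorusConfigEquivSite G (2 * L + 1)).symm V)))) = aF r u := by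
  funext V
  obtain ⟨U, rfl⟩ : ∃ U, V = finTorusConfigEquivSite G (2 * L + 1) U :=
    ⟨(finTorusConfigEquivSite G (2 * L + 1)).symm V, by simp⟩
  rw [MeasurableEquiv.symm_apply_apply, dens_torusLift_eq_psiZ, proj_zOf, psiZ_sitePerm, configPerm_symm_apply', aF_equiv]

end Expect


/-! ### The `Fin`-site read at a `ℤ⁴` link, and its torus distance to the origin / to a time slice -/

/-- Components of the `Fin`-site read at the `ℤ⁴` link `e = ((t, x¹, x², x³), ν)`: `(x¹, x², x³, t) mod T`. [folklore] -/
theorem finLink_fst (L : ℕ) (e : Literature.MathematicalPhysics.QuantumLattice.ZdEdge 4) :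
    ((finTorusSiteEquivSite (2 * L + 1)).symm (Literature.MathematicalPhysics.QuantumFieldTheory.sitePerm (finRotate 4).symm (Torus.proj (2 * L + 1) e.1)), (finRotate 4).symm e.2).1 =
      (((e.1 1 : ℤ) : ZMod (2 * L + 1)), ((e.1 2 : ℤ) : ZMod (2 * L + 1)), ((e.1 3 : ℤ) : ZMod (2 * L + 1)),
        ((e.1 0 : ℤ) : ZMod (2 * L + 1))) := by
  simp only [finTorusSiteEquivSite, Equiv.coe_fn_symm_mk,
    Literature.MathematicalPhysics.QuantumFieldTheory.sitePerm_apply, Equiv.symm_symm, Torus.proj_apply]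
  refine Prod.ext ?_ (Prod.ext ?_ (Prod.ext ?_ ?_)) <;> simp [ZMod.finEquiv] <;> rfl

/-- Torus distance to `0` of the residue of a small integer. [folklore] -/
theorem min_val_intCast_le (L : ℕ) {z : ℤ} {m : ℕ} (hz : |z| ≤ m) (hm : m ≤ 2 * L) :
    min (Fin.val ((z : ℤ) : ZMod (2 * L + 1))) (2 * L + 1 - Fin.val ((z : ℤ) : ZMod (2 * L + 1))) ≤ m := by
  have hv : ((Fin.val ((z : ℤ) : ZMod (2 * L + 1)) : ℕ) : ℤ) = z % ((2 * L + 1 : ℕ) : ℤ) :=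
    ZMod.val_intCast (n := 2 * L + 1) z
  obtain ⟨hz1, hz2⟩ := abs_le.1 hz
  by_cases h0 : 0 ≤ z
  · refine min_le_of_left_le ?_
    have : z % ((2 * L + 1 : ℕ) : ℤ) = z := Int.emod_eq_of_lt h0 (by push_cast; omega)
    omega
  · refine min_le_of_right_le ?_
    have h1 : z % ((2 * L + 1 : ℕ) : ℤ) = z + (2 * L + 1 : ℕ) := by
      rw [Int.emod_eq_add_self_emod]
      exact Int.emod_eq_of_lt (by push_cast; omega) (by push_cast; omega)
    omega

/-- Torus distance to the slice `h` of the residue of a time in `[0, T)`. [folklore] -/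
theorem min_natAbs_val_intCast_le (L : ℕ) {t : ℤ} {h m : ℕ} (ht0 : 0 ≤ t) (htT : t ≤ 2 * L) (hth : |t - h| ≤ m) :
    min (Int.natAbs ((Fin.val ((t : ℤ) : ZMod (2 * L + 1)) : ℤ) - h))
      (2 * L + 1 - Int.natAbs ((Fin.val ((t : ℤ) : ZMod (2 * L + 1)) : ℤ) - h)) ≤ m := by
  have hv : ((Fin.val ((t : ℤ) : ZMod (2 * L + 1)) : ℕ) : ℤ) = t % ((2 * L + 1 : ℕ) : ℤ) :=
    ZMod.val_intCast (n := 2 * L + 1) t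
  have : t % ((2 * L + 1 : ℕ) : ℤ) = t := Int.emod_eq_of_lt ht0 (by push_cast; omega)
  refine min_le_of_left_le ?_
  obtain ⟨h1, h2⟩ := abs_le.1 hth
  omega

end Summit.QuantumFields.YangMills.Theorems.AntipodalMarkovDictionary
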